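import Summits.BirchSwinnertonDyer.Rank1Residual.X10.SecondDescentOneLineAnyTorsion
import Literature.NumberTheory.EllipticCurves.BSDRankZeroDensityProofs
import HarnessLib

/-!
# The RANK-ONE one-line door: `#Sel^(p)(E/ℚ) ≤ p^{r_an + 2}` + ONE non-divisible class of `Ш[p]` + bsd.S18 ⇒ `#Ш(E/ℚ)(p) = p²` ⇒ `BSD(E,p)` in analytic rank `≤ 1` — the door for the rank-`1` Ш-cells with `#Ш_an = 9` at `p = 3` (cell `b2b-bsdres`, unit `b2b-bsdres-x10`, gen 57)

HONEST FRAMING (run/shared/lean/b2b/bsd-rank1-residual/, verbatim in every file): the goal of the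
cell is to DELETE the COMBINATION-SHAPED residual classes of the Birch–Swinnerton-Dyer formula for
ALL analytic-rank `≤ 1` elliptic curves over `ℚ` — "full BSD formula for every rank `≤ 1` curve in
class `C`" assembled STRICTLY from published theorems — so that the rank-`≤ 1` remainder becomes
exactly the CONSTRUCTION-SHAPED classes, which are TYPED (missing-input `Prop`s), NOT attempted.
This is not "finishing BSD". Theorems only (no definition, no new named fact); NOTHING IS BOOKED
here; no class label changes (X4 / X7 / X11b keep their marks and their class-level typed inputs).
Per pair.

**What this file is.** Every second-`3`-descent door of the cell so far (`X10/SecondDescentNine`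
p556861, `X10/SecondDescentOneLine` p685094, `X10/SecondDescentOneLineBound` p688153,
`X10/SecondDescentOneLineAnyTorsion` p696472) displays `hr : r_an = 0`: at rank `0` the descent count
`#Sel^(p)(E/ℚ) = p²` IS `#Ш[p] = p²`. The book's remaining Ш-cells at `3` with `ord₃ #Ш_an = 2` are
RANK-ONE: (3, X11b) `191424ce1`, `318828a1`, `368358k1`, `463488bg1`, `498525ca1`; (3, X4) `133956n1`,
`213390h1`, `310329i1`, `484128bu1`; (3, X7) `445280bc1` (x10 gen 56 census, `JETREM-NEXT.md` §3: "no
door yet"). This file is that door, and nothing in it is new mathematics: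

* §1 (any number field, any rank, any torsion): the tree's PROVED exact descent count
  `#Sel^(p)(E/K) = p^{rank E(K)} · #E(K)[p] · #Ш(E/K)[p]` (Silverman AEC X.4.2(a);
  `WeierstrassCurve.natCard_selmerGroup_eq`, `Literature/…/BSDRankZeroDensityProofs`) turns the
  descent certificate `#Sel^(p) ≤ p^{rank + m}` into the bound `#Ш[p] ≤ p^m`
  (`natCard_sha_torsionBy_le_of_card_selmerGroup_le`) — the torsion factor only helps;
* §2 (over `ℚ`, analytic rank `≤ 1`): the torsion-agnostic one-line door of
  `X10/SecondDescentOneLineAnyTorsion` with its binder `hr : r_an = 0` RELAXED to `r_an ≤ 1` — its proof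
  used `r_an = 0` only to invoke Gross–Zagier–Kolyvagin (`hGZK`: rank `= r_an`, `Ш` finite), which is
  stated for `r_an ≤ 1` (`bsdp_of_card_le_of_oneNonDivisible_of_analyticRank_le_one`); composed with §1
  and GZK's `rank = r_an`: `bsdp_of_card_selmerGroup_le_of_oneNonDivisible` — bsd.S18 (`hCT`,
  DISPLAYED: Cassels 1962 = AEC X.4.14, tree named fact `WeierstrassCurve.exists_casselsTate_pairing`),
  GZK, `#Sel^(p) ≤ p^{r_an+2}`, ONE non-zero class of `Ш[p]` not divisible by `p`, `ord_p #Ш_an = 2`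
  ⇒ Miller's `BSD(E,p)` (`#Ш(E/ℚ)(p) = p²` exactly: squareness from `1 < #Ш[p] ≤ p²` under the
  alternating non-degenerate pairing, `Ш[p²] = Ш[p]` from the Gram partner of the non-divisible class —
  `X10.sq_nsmul_stable_of_gram`, gen 10);
* §3 the record shapes at `p = 3`: `bsdp_three_of_card_selmerThree_le_of_oneNonDivisible`
  (`r_an ≤ 1`, `#Sel³ ≤ 3^{r_an+2}`) and the rank-one literal form
  `bsdp_three_rankOne_of_card_selmerThree_of_oneNonDivisible (hCT) (hGZK) (W) (hr : r_an = 1)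
  (hcard : #Sel³(E/ℚ) = 27) (h1) (hq) (hv : ord₃ q = 2) : BSDp W 3`, plus the exact `3`-parts.

**The certificate a record cites** (per curve, two engines written apart per input, as on every C9
record): (a) `dim_𝔽₃ Sel^(3)(E/ℚ) = 3` (`#Sel³ = 27`; x11b `desc3lib.gp` EXACT(bnfcertify1+3sat) ‖
x10b `desc3full_e2.py`); (b) ONE plane cubic `C_η`, `η ∈ Sel^(3)(E/ℚ)`, whose `3`-Selmer SET is EMPTY
(Creutz 2014 Thm. 7.2 / Alg. 7.3; `ninedesc.gp` ‖ `ninedesc_e2_et.py`). In rank one (b) needs NO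
Mordell–Weil datum: the Kummer image `κ₃(E(ℚ)) = 3·κ₉(E(ℚ))` lies inside `3·Sel^(9)(E/ℚ)`, so
`Sel^(3)(C_η) = ∅` — i.e. `η ∉ 3·Sel^(9)` — gives both `[C_η] ≠ 0` in `Ш` (as `η ∉ κ₃(E(ℚ))`) and
`[C_η] ∉ 3·Ш` (as `η ∉ 3·Sel^(9) + κ₃(E(ℚ)) = 3·Sel^(9)`); a cubic on the Mordell–Weil line has a
rational point and is never cited. No pairing VALUE, no main conjecture, no image / reduction /
torsion hypothesis.

References: Cassels 1962 (IV) [Cassels1962ArithmeticIV]; Cassels 1998 §1 [Cassels1998]; Silverman AEC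
Thm. X.4.2(a), X.4.14 [SilvermanAEC2009]; B. Creutz, Math. Comp. 83 (2014) Thm. 7.2, Alg. 7.3
[Creutz2014]; R. L. Miller 2011 §1 and Def. 1.1 [Miller2011LMS]; companions
`X10/SecondDescentOneLineAnyTorsion` (p696472), `X10/SecondDescentOneLineBound` (p688153),
`X10/CasselsTatePairingCertificate` (p213922), `Literature/…/BSDRankZeroDensityProofs`
(`natCard_selmerGroup_eq`); cell files X10-AUDIT.md §63, `b2b-bsdres-x10/g56/JETREM-NEXT.md` §3.
-/

set_option autoImplicit false

noncomputable section

open scoped Classical AddSubgroup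

open WeierstrassCurve Literature.NumberTheory.EllipticCurves
  Literature.NumberTheory.EllipticCurves.Rank1Residual
  Literature.NumberTheory.EllipticCurves.Rank1Residual.Typed
  Literature.NumberTheory.EllipticCurves.Rank1Residual.X11RankOneCertificates
  Literature.GroupTheory.FiniteAbelian
  Summit.BirchSwinnertonDyer.BirchSwinnertonDyer.Rank1Residual.IntModel
  Summit.BirchSwinnertonDyer.BirchSwinnertonDyer.Rank1Residual.X11RankOne
  Summit.BirchSwinnertonDyer.Rank1Residual.X11b

namespace Summit.BirchSwinnertonDyer.Rank1Residual.X10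

/-! ### §1 Any number field, any rank, any torsion: `#Sel^(p) ≤ p^{rank + m}` ⇒ `#Ш[p] ≤ p^m` -/

section General

variable {K : Type*} [Field K] [NumberField K] (W : WeierstrassCurve K) [W.IsElliptic]

/-- **The descent certificate bounds `Ш[p]`: `#Sel^(p)(E/K) ≤ p^{rank E(K) + m}` ⇒ `#Ш(E/K)[p] ≤ p^m`.**
From the PROVED exact count `#Sel^(p) = p^{rank} · #E(K)[p] · #Ш[p]` (AEC X.4.2(a),
`natCard_selmerGroup_eq`; `Sel^(p)` finite, so `#E(K)[p] ≥ 1`): divide by `p^{rank}` and drop the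
torsion factor. No hypothesis on `E(K)_tors`, on the rank, or on `Ш`.
[cite: SilvermanAEC2009, Thm X.4.2(a)] -/
theorem natCard_sha_torsionBy_le_of_card_selmerGroup_le (p : ℕ) [hp : Fact p.Prime] {m : ℕ}
    (hcard : Nat.card (W.selmerGroup (p : ℤ)) ≤ p ^ (W.mordellWeilRank + m)) :
    Nat.card (AddSubgroup.torsionBy W.sha p) ≤ p ^ m := by
  have hp0 : p ≠ 0 := hp.out.ne_zero
  have hp0' : (p : ℤ) ≠ 0 := Int.natCast_ne_zero.mpr hp0
  haveI : Finite (W.selmerGroup (p : ℤ)) := W.finite_selmerGroup_holds hp0'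
  have hSel := W.natCard_selmerGroup_eq hp0
  have hSel0 : Nat.card (W.selmerGroup (p : ℤ)) ≠ 0 := Nat.card_pos.ne'
  have hE1 : 1 ≤ Nat.card (W.toAffine.Point[(p : ℤ)]) := by
    refine Nat.one_le_iff_ne_zero.mpr fun h => hSel0 ?_
    rw [hSel, h, mul_zero, zero_mul]
  rw [card_torsionBy_coe_eq_card_inf W.sha p]
  have hpr : 0 < p ^ W.mordellWeilRank := pow_pos hp.out.pos _
  refine Nat.le_of_mul_le_mul_left ?_ hpr
  calc p ^ W.mordellWeilRank * Nat.card ↥(W.sha ⊓ AddSubgroup.torsionBy W.galH1 p)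
      ≤ p ^ W.mordellWeilRank * Nat.card (W.toAffine.Point[(p : ℤ)]) *
          Nat.card ↥(W.sha ⊓ AddSubgroup.torsionBy W.galH1 p) := by
        rw [mul_assoc]
        exact Nat.mul_le_mul_left _ (Nat.le_mul_of_pos_left _ hE1)
    _ = Nat.card (W.selmerGroup (p : ℤ)) := hSel.symm
    _ ≤ p ^ (W.mordellWeilRank + m) := hcard
    _ = p ^ W.mordellWeilRank * p ^ m := pow_add _ _ _

/-- **`#Ш(E/K)(p) = p²` from bsd.S18, the descent certificate `#Sel^(p) ≤ p^{rank + 2}` and ONE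
non-divisible non-zero class of `Ш[p]`** (`Ш` finite; any rank, any torsion): §1 gives `#Ш[p] ≤ p²`,
then `card_primaryComponent_sha_eq_sq_of_oneNonDivisible_of_card_le` (the torsion-agnostic door's §1:
squareness + Gram partner under the displayed alternating non-degenerate Cassels–Tate pairing).
[cite: Cassels1962ArithmeticIV] [cite: Cassels1998, §1] [cite: SilvermanAEC2009, Thm X.4.2(a) and Thm. X.4.14] -/
theorem card_primaryComponent_sha_eq_sq_of_oneNonDivisible_of_card_selmerGroup_le
    (hCT : exists_casselsTate_pairing (K := K)) [Finite W.sha] (p : ℕ) [Fact p.Prime]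
    (hcard : Nat.card (W.selmerGroup (p : ℤ)) ≤ p ^ (W.mordellWeilRank + 2))
    (h1 : ∃ x : W.sha, p • x = 0 ∧ x ≠ 0 ∧ ∀ z : W.sha, p • z ≠ x) :
    Nat.card (AddCommGroup.primaryComponent W.sha p) = p ^ 2 :=
  card_primaryComponent_sha_eq_sq_of_oneNonDivisible_of_card_le W hCT p
    (natCard_sha_torsionBy_le_of_card_selmerGroup_le W p hcard) h1

end General

/-! ### §2 Over `ℚ`, analytic rank `≤ 1`: Miller's `BSD(E,p)` from GZK + bsd.S18 + `#Sel^(p) ≤ p^{r_an+2}` + ONE line -/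

section OverQ

variable (W : WeierstrassCurve ℚ) [W.IsElliptic] (p : ℕ) [Fact p.Prime]

/-- **The torsion-agnostic one-line door in analytic rank `≤ 1`** (= `bsdp_of_card_le_of_oneNonDivisible`
of `X10/SecondDescentOneLineAnyTorsion` with `hr : r_an = 0` relaxed to `r_an ≤ 1`; same proof):
Gross–Zagier–Kolyvagin (`hGZK`) gives `rank = r_an` and `Ш` finite; bsd.S18 (`hCT`), `#Ш[p] ≤ p²`, ONE
non-divisible non-zero class of `Ш[p]` give `#Ш(E/ℚ)(p) = p²`; Miller's clause (iv) is `ord_p q = 2`.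
Class-free, image-free, torsion-free; per curve. [cite: Miller2011LMS, §1 and Def. 1.1]
[cite: Creutz2014, Thm. 7.2] [cite: Cassels1962ArithmeticIV] [cite: SilvermanAEC2009, Thm. X.4.14] -/
theorem bsdp_of_card_le_of_oneNonDivisible_of_analyticRank_le_one
    (hCT : exists_casselsTate_pairing (K := ℚ)) (hGZK : rank_eq_analyticRank_of_analyticRank_le_one)
    (hr : W.analyticRank ≤ 1)
    (hub : Nat.card (AddSubgroup.torsionBy W.sha p) ≤ p ^ 2)
    (h1 : ∃ x : W.sha, p • x = 0 ∧ x ≠ 0 ∧ ∀ z : W.sha, p • z ≠ x)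
    {q : ℚ} (hq : shaAn W = (q : ℂ)) (hv : padicValRat p q = 2) : BSDp W p := by
  obtain ⟨hrank', hfin⟩ := hGZK W hr
  haveI : Finite W.sha := hfin
  refine ⟨hrank', Finite.of_injective _ Subtype.val_injective, q, hq, ?_⟩
  rw [card_primaryComponent_sha_eq_sq_of_oneNonDivisible_of_card_le W hCT p hub h1,
    padicValNat.prime_pow]
  exact_mod_cast hv

/-- **The exact `p`-part in analytic rank `≤ 1`, no analytic value and no torsion hypothesis:
`ord_p #Ш(E/ℚ) = 2`** from GZK, bsd.S18, `#Ш[p] ≤ p²` and ONE line.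
[cite: Cassels1962ArithmeticIV] [cite: Creutz2014, Thm. 7.2] -/
theorem padicValNat_shaOrder_eq_two_of_card_le_of_oneNonDivisible_of_analyticRank_le_one
    (hCT : exists_casselsTate_pairing (K := ℚ)) (hGZK : rank_eq_analyticRank_of_analyticRank_le_one)
    (hr : W.analyticRank ≤ 1)
    (hub : Nat.card (AddSubgroup.torsionBy W.sha p) ≤ p ^ 2)
    (h1 : ∃ x : W.sha, p • x = 0 ∧ x ≠ 0 ∧ ∀ z : W.sha, p • z ≠ x) :
    padicValNat p W.shaOrder = 2 := by
  haveI : Finite W.sha := (hGZK W hr).2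
  rw [WeierstrassCurve.shaOrder, ← padicValNat_card_addPrimaryComponent (A := W.sha) p,
    card_primaryComponent_sha_eq_sq_of_oneNonDivisible_of_card_le W hCT p hub h1,
    padicValNat.prime_pow]

/-- **`BSD(E,p)` in analytic rank `≤ 1` from the descent COUNT `#Sel^(p)(E/ℚ) ≤ p^{r_an + 2}`, the
Cassels–Tate pairing fact, ONE non-divisible non-zero class of `Ш[p]`, and `ord_p #Ш_an = 2`.** GZK
(`hGZK`) turns `r_an` into `rank E(ℚ)`; §1 turns the count into `#Ш[p] ≤ p²`; then the previous door.
At rank `1`, `p = 3` this is the certificate `dim Sel³ = 3` + ONE EMPTY second `3`-descent. Class-free,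
image-free, torsion-free; per curve. [cite: Miller2011LMS, §1 and Def. 1.1] [cite: Creutz2014, Thm. 7.2 and Alg. 7.3]
[cite: Cassels1962ArithmeticIV] [cite: SilvermanAEC2009, Thm X.4.2(a) and Thm. X.4.14] -/
theorem bsdp_of_card_selmerGroup_le_of_oneNonDivisible
    (hCT : exists_casselsTate_pairing (K := ℚ)) (hGZK : rank_eq_analyticRank_of_analyticRank_le_one)
    (hr : W.analyticRank ≤ 1)
    (hcard : Nat.card (W.selmerGroup (p : ℤ)) ≤ p ^ (W.analyticRank + 2))
    (h1 : ∃ x : W.sha, p • x = 0 ∧ x ≠ 0 ∧ ∀ z : W.sha, p • z ≠ x)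
    {q : ℚ} (hq : shaAn W = (q : ℂ)) (hv : padicValRat p q = 2) : BSDp W p := by
  have hrank : W.mordellWeilRank = W.analyticRank := (hGZK W hr).1
  exact bsdp_of_card_le_of_oneNonDivisible_of_analyticRank_le_one W p hCT hGZK hr
    (natCard_sha_torsionBy_le_of_card_selmerGroup_le W p (m := 2) (by rw [hrank]; exact hcard))
    h1 hq hv

/-- **The exact `p`-part from the same data: `ord_p #Ш(E/ℚ) = 2`** (`#Ш(E/ℚ)[p^∞] = p²`).
[cite: Cassels1962ArithmeticIV] [cite: Creutz2014, Thm. 7.2] [cite: SilvermanAEC2009, Thm X.4.2(a)] -/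
theorem padicValNat_shaOrder_eq_two_of_card_selmerGroup_le_of_oneNonDivisible
    (hCT : exists_casselsTate_pairing (K := ℚ)) (hGZK : rank_eq_analyticRank_of_analyticRank_le_one)
    (hr : W.analyticRank ≤ 1)
    (hcard : Nat.card (W.selmerGroup (p : ℤ)) ≤ p ^ (W.analyticRank + 2))
    (h1 : ∃ x : W.sha, p • x = 0 ∧ x ≠ 0 ∧ ∀ z : W.sha, p • z ≠ x) :
    padicValNat p W.shaOrder = 2 := by
  have hrank : W.mordellWeilRank = W.analyticRank := (hGZK W hr).1
  exact padicValNat_shaOrder_eq_two_of_card_le_of_oneNonDivisible_of_analyticRank_le_one W p hCT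
    hGZK hr (natCard_sha_torsionBy_le_of_card_selmerGroup_le W p (m := 2) (by rw [hrank]; exact hcard))
    h1

end OverQ

/-! ### §3 The record shapes at `p = 3` (image-free, reduction-type-free, torsion-agnostic; the record substitutes the literal model) -/

/-- **Record shape, analytic rank `≤ 1`:** bsd.S18 (`hCT`), GZK, `r_an ≤ 1`, the two-engine descent
count `#Sel³(E/ℚ) ≤ 3^{r_an+2}`, ONE non-zero class of `Ш[3]` not divisible by `3` (two-engine EMPTY
second `3`-descent on a plane cubic `C_η`, Creutz 2014 §7), `ord₃ #Ш_an = 2` ⇒ Miller's `BSD(E,3)`.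
Per pair; books nothing. [cite: Creutz2014, Thm. 7.2 and Alg. 7.3] [cite: Cassels1962ArithmeticIV]
[cite: Miller2011LMS, Def. 1.1] [cite: SilvermanAEC2009, Thm X.4.2(a) and Thm. X.4.14] -/
theorem bsdp_three_of_card_selmerThree_le_of_oneNonDivisible
    (hCT : exists_casselsTate_pairing (K := ℚ)) (hGZK : rank_eq_analyticRank_of_analyticRank_le_one)
    (W : WeierstrassCurve ℚ) [W.IsElliptic] (hr : W.analyticRank ≤ 1)
    (hcard : Nat.card (W.selmerGroup (3 : ℤ)) ≤ 3 ^ (W.analyticRank + 2))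
    (h1 : ∃ x : W.sha, 3 • x = 0 ∧ x ≠ 0 ∧ ∀ z : W.sha, 3 • z ≠ x)
    {q : ℚ} (hq : shaAn W = (q : ℂ)) (hv : padicValRat 3 q = 2) : BSDp W 3 := by
  haveI : Fact (Nat.Prime 3) := ⟨by norm_num⟩
  exact bsdp_of_card_selmerGroup_le_of_oneNonDivisible W 3 hCT hGZK hr (by exact_mod_cast hcard)
    h1 hq hv

/-- **The exact `3`-part under the same data: `ord₃ #Ш(E/ℚ) = 2`.** [cite: Cassels1962ArithmeticIV]
[cite: Creutz2014, Thm. 7.2] -/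
theorem padicValNat_shaOrder_three_eq_two_of_card_selmerThree_le_of_oneNonDivisible
    (hCT : exists_casselsTate_pairing (K := ℚ)) (hGZK : rank_eq_analyticRank_of_analyticRank_le_one)
    (W : WeierstrassCurve ℚ) [W.IsElliptic] (hr : W.analyticRank ≤ 1)
    (hcard : Nat.card (W.selmerGroup (3 : ℤ)) ≤ 3 ^ (W.analyticRank + 2))
    (h1 : ∃ x : W.sha, 3 • x = 0 ∧ x ≠ 0 ∧ ∀ z : W.sha, 3 • z ≠ x) :
    padicValNat 3 W.shaOrder = 2 := by
  haveI : Fact (Nat.Prime 3) := ⟨by norm_num⟩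
  exact padicValNat_shaOrder_eq_two_of_card_selmerGroup_le_of_oneNonDivisible W 3 hCT hGZK hr
    (by exact_mod_cast hcard) h1

/-- **Record shape, RANK ONE, literal count: `r_an = 1`, `#Sel³(E/ℚ) = 27` (`dim_𝔽₃ Sel³ = 3` on two
engines), ONE EMPTY second `3`-descent line, `ord₃ #Ш_an = 2`, bsd.S18, GZK ⇒ `BSD(E,3)`.** The door
for the rank-one `#Ш_an = 9` cells of the book at `3` ((3, X11b) ×5, (3, X4) ×4, (3, X7) ×1 on the
2026-08-30 census). Per pair; books nothing; class marks untouched. [cite: Creutz2014, Thm. 7.2 and Alg. 7.3]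
[cite: Cassels1962ArithmeticIV] [cite: Miller2011LMS, Def. 1.1] [cite: SilvermanAEC2009, Thm X.4.2(a) and Thm. X.4.14] -/
theorem bsdp_three_rankOne_of_card_selmerThree_of_oneNonDivisible
    (hCT : exists_casselsTate_pairing (K := ℚ)) (hGZK : rank_eq_analyticRank_of_analyticRank_le_one)
    (W : WeierstrassCurve ℚ) [W.IsElliptic] (hr : W.analyticRank = 1)
    (hcard : Nat.card (W.selmerGroup (3 : ℤ)) = 27)
    (h1 : ∃ x : W.sha, 3 • x = 0 ∧ x ≠ 0 ∧ ∀ z : W.sha, 3 • z ≠ x)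
    {q : ℚ} (hq : shaAn W = (q : ℂ)) (hv : padicValRat 3 q = 2) : BSDp W 3 :=
  bsdp_three_of_card_selmerThree_le_of_oneNonDivisible hCT hGZK W (by rw [hr])
    (by rw [hr, hcard]; norm_num) h1 hq hv

/-- **The exact `3`-part on a rank-one pair with `#Sel³ = 27` and ONE EMPTY line: `ord₃ #Ш(E/ℚ) = 2`**
(`#Ш(E/ℚ)[3^∞] = 9`), no analytic value used. [cite: Cassels1962ArithmeticIV] [cite: Creutz2014, Thm. 7.2]
[cite: SilvermanAEC2009, Thm X.4.2(a)] -/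
theorem padicValNat_shaOrder_three_eq_two_rankOne_of_card_selmerThree_of_oneNonDivisible
    (hCT : exists_casselsTate_pairing (K := ℚ)) (hGZK : rank_eq_analyticRank_of_analyticRank_le_one)
    (W : WeierstrassCurve ℚ) [W.IsElliptic] (hr : W.analyticRank = 1)
    (hcard : Nat.card (W.selmerGroup (3 : ℤ)) = 27)
    (h1 : ∃ x : W.sha, 3 • x = 0 ∧ x ≠ 0 ∧ ∀ z : W.sha, 3 • z ≠ x) :
    padicValNat 3 W.shaOrder = 2 :=
  padicValNat_shaOrder_three_eq_two_of_card_selmerThree_le_of_oneNonDivisible hCT hGZK W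
    (by rw [hr]) (by rw [hr, hcard]; norm_num) h1

end Summit.BirchSwinnertonDyer.Rank1Residual.X10

end
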